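import Summits.BirchSwinnertonDyer.Rank1Residual.X11b.BDPRouteOpenInputDescent
import HarnessLib

set_option linter.dupNamespace false -- `Summit.BirchSwinnertonDyer.BirchSwinnertonDyer.Theorems.…` (summit = sub)
set_option autoImplicit false

/-!
# Crux (E♭°) `EisensteinDivisibilityCMInertBadFlatAtOne` (stmt-BirchSwinnertonDyer-20452), line `birth`:
# stub `stub_Ea` REDUCED to the existence of one `R₀`-frame — an `R₀`-frame and a ♭-frame of the same
# `(ι′, 𝔭, κ, γ, f)` generate the SAME ideal of `𝓞_{ℂ_p}⟦T⟧`, whatever their periods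

Route `BiquadraticEisensteinDescent` (cell `pub/bsd-wall`, lead-prover seat `bsd-wall-bed-p1`, g2). The
registered birth skeleton of the rev-8 crux (planner seat `bsd-wall-cm` g3, sha16 `07fa5b7b55928bfe`)
composes (E♭°) from `stub_Ea` (ideal comparison ♭-frame ↔ `R₀`-frame), `stub_E1B`, `stub_E2` and the
landed `stub_E3`. This file settles the COMPARISON half of `stub_Ea` outright, from the tree:

* `span_map_eq_span_of_isBDPLFunction_of_isBDPLFunctionInt` — at an odd prime `p`, over an imaginary
  quadratic `K`, for an anticyclotomic `κ` with topological generator `γ`: if `L₁ ∈ R₀⟦T⟧` satisfies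
  Castella's interpolation property `IsBDPLFunction ι 𝔭 κ γ f Ω_K₁ Ω_p₁ L₁` and `Q ∈ 𝓞_{ℂ_p}⟦T⟧`
  satisfies the same property in the wide receptacle, `X11b.R1.IsBDPLFunctionInt p ι 𝔭 κ γ f Ω_K Ω_p Q`,
  with ALL FOUR periods non-zero but otherwise arbitrary, then `(L₁)·𝓞_{ℂ_p}⟦T⟧ = (Q)`.
  Proof: read `L₁` in `𝓞_{ℂ_p}⟦T⟧` (`X11b.R1.isBDPLFunctionInt_map`, same values) and apply the
  cell b2b-bsdres IDEAL RIGIDITY ACROSS PERIODS `X11b.R1.span_singleton_eq_of_isBDPLFunctionInt`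
  (two ♭-frames differ by a unit of `𝓞_{ℂ_p}⟦T⟧`; the test points are the powers of multr1-p2's
  interpolation character, `X11b/FrameIdealRigidity.lean`).
* `stub_Ea_of_isBDPLFunction` — hence the CONCLUSION of the registered `stub_Ea` (`∃ Ω_K₁ Ω_p₁ L₁,
  Ω_K₁ ≠ 0 ∧ IsBDPLFunction … L₁ ∧ Ideal.span {map L₁} = Ideal.span {Q}`) holds at every ♭-frame `Q`
  (`Ω_K ≠ 0`, `Ω_p ∈ R₀ˣ`) as soon as ONE `R₀`-frame `(Ω_K₁ ≠ 0, Ω_p₁ ∈ R₀ˣ, L₁)` of the same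
  `(ι′, 𝔭, κ, γ, f)` exists, for `p ≠ 2`. What remains of `stub_Ea` is therefore exactly the EXISTENCE
  of an `R₀`-valued frame at an additive CM-inert prime (re-registered by the lead as `stub_E0`); the
  binders of the crux that this file does not use (CM, rank, `p ≥ 5`, admissibility, `𝔭` of degree one,
  the newform) are not assumed.

THEOREMS ONLY (no definition, no named fact, no `sorry`); imports no `Theses` module; nothing about any
curve, frame existence or main conjecture is asserted. Supports, does not close, stmt-BirchSwinnertonDyer-20452.

References: [Castella2018] F. Castella, Camb. J. Math. 6 (2018), Thm. 3.1 (arXiv:1704.06608 p. 9);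
[CastellaHsieh2018] Math. Ann. 370 (2018), §3.3, Def. 3.5, Prop. 3.6; [Washington1997] §5.1.
-/

noncomputable section

open scoped Classical

open PowerSeries NumberField IsDedekindDomain Field
  Literature.NumberTheory.EllipticCurves Literature.NumberTheory.GaloisRepresentations
  Summit.BirchSwinnertonDyer.Rank1Residual.X11b

namespace Summit.BirchSwinnertonDyer.BirchSwinnertonDyer.Theorems.BiquadraticEisensteinDescentEisensteinDivisibilityCMInertBadFlatAtOneStubEa

variable {p : ℕ} [Fact p.Prime] {K : Type} [Field K] [NumberField K] {N : ℕ}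
  {ι : PadicAlgCl p ≃+* ℂ} {𝔭 : HeightOneSpectrum (𝓞 K)} {κ : ZpExtension K p}
  {γ : Field.absoluteGaloisGroup K} {f : CuspForm (CongruenceSubgroup.Gamma0 N) 2}

/-- **An `R₀`-frame and a ♭-frame of the same `(ι, 𝔭, κ, γ, f)` generate the same ideal of
`𝓞_{ℂ_p}⟦T⟧`, whatever their (non-zero) periods.** For `p` odd, `K` imaginary quadratic, `κ`
anticyclotomic with topological generator `γ`: `IsBDPLFunction ι 𝔭 κ γ f Ω_K₁ Ω_p₁ L₁` (`L₁ ∈ R₀⟦T⟧`)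
and `X11b.R1.IsBDPLFunctionInt p ι 𝔭 κ γ f Ω_K Ω_p Q` (`Q ∈ 𝓞_{ℂ_p}⟦T⟧`) with `Ω_K, Ω_K₁, Ω_p, Ω_p₁ ≠ 0`
give `Ideal.span {map (R₀ → 𝓞_{ℂ_p}) L₁} = Ideal.span {Q}`. (`R1.isBDPLFunctionInt_map` + the ideal
rigidity across periods `R1.span_singleton_eq_of_isBDPLFunctionInt` of `X11b/FrameIdealRigidity.lean`.)
[cite: Castella2018, Thm. 3.1 (arXiv:1704.06608 p. 9)]
[cite: CastellaHsieh2018, §3.3, Def. 3.5 and Prop. 3.6] -/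
theorem span_map_eq_span_of_isBDPLFunction_of_isBDPLFunctionInt (hp2 : p ≠ 2)
    (hK : IsImaginaryQuadratic K) (hκ : κ.IsAnticyclotomic) (hγ : κ.IsTopGenerator γ)
    {ΩK ΩK₁ : ℂ} {Ωp Ωp₁ : ℂ_[p]} {Q : PowerSeries 𝓞_ℂ_[p]} {L₁ : UnrSeries p}
    (hΩK : ΩK ≠ 0) (hΩK₁ : ΩK₁ ≠ 0) (hΩp : Ωp ≠ 0) (hΩp₁ : Ωp₁ ≠ 0)
    (hQ : R1.IsBDPLFunctionInt p ι 𝔭 κ γ f ΩK Ωp Q) (hL₁ : IsBDPLFunction ι 𝔭 κ γ f ΩK₁ Ωp₁ L₁) :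
    Ideal.span {PowerSeries.map (R1.unrToCpInt p) L₁} = Ideal.span {Q} :=
  R1.span_singleton_eq_of_isBDPLFunctionInt hp2 hK hκ hγ hΩK hΩK₁ hΩp hΩp₁ hQ
    (R1.isBDPLFunctionInt_map hL₁)

/-- **`stub_Ea` from ONE `R₀`-frame.** For `p ≠ 2`, `K` imaginary quadratic, `κ` anticyclotomic, `γ` a
topological generator: given ANY `R₀`-frame `(Ω_K₁ ≠ 0, Ω_p₁ ∈ R₀ˣ, L₁)` of `(ι, 𝔭, κ, γ, f)`, every
♭-frame `Q` (`Ω_K ≠ 0`, `Ω_p ∈ R₀ˣ`) of the same datum satisfies the conclusion of the registered stub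
`stub_Ea` of crux (E♭°): `∃ Ω_K₁ Ω_p₁ L₁, Ω_K₁ ≠ 0 ∧ IsBDPLFunction ι 𝔭 κ γ f Ω_K₁ Ω_p₁ L₁ ∧
Ideal.span {map L₁} = Ideal.span {Q}` — with the given frame as witness.
[cite: Castella2018, Thm. 3.1 (arXiv:1704.06608 p. 9)] -/
theorem stub_Ea_of_isBDPLFunction (hp2 : p ≠ 2) (hK : IsImaginaryQuadratic K)
    (hκ : κ.IsAnticyclotomic) (hγ : κ.IsTopGenerator γ)
    {ΩK₁ : ℂ} {Ωp₁ : (unrIntegers p)ˣ} {L₁ : UnrSeries p} (hΩK₁ : ΩK₁ ≠ 0)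
    (hL₁ : IsBDPLFunction ι 𝔭 κ γ f ΩK₁ ((Ωp₁ : unrIntegers p) : ℂ_[p]) L₁)
    {ΩK : ℂ} {Ωp : (unrIntegers p)ˣ} {Q : PowerSeries 𝓞_ℂ_[p]} (hΩK : ΩK ≠ 0)
    (hQ : R1.IsBDPLFunctionInt p ι 𝔭 κ γ f ΩK ((Ωp : unrIntegers p) : ℂ_[p]) Q) :
    ∃ (ΩK₁ : ℂ) (Ωp₁ : (unrIntegers p)ˣ) (L₁ : UnrSeries p), ΩK₁ ≠ 0 ∧
      IsBDPLFunction ι 𝔭 κ γ f ΩK₁ ((Ωp₁ : unrIntegers p) : ℂ_[p]) L₁ ∧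
      Ideal.span {PowerSeries.map (R1.unrToCpInt p) L₁} = Ideal.span {Q} :=
  ⟨ΩK₁, Ωp₁, L₁, hΩK₁, hL₁,
    span_map_eq_span_of_isBDPLFunction_of_isBDPLFunctionInt hp2 hK hκ hγ hΩK hΩK₁
      (coe_units_unrIntegers_ne_zero Ωp) (coe_units_unrIntegers_ne_zero Ωp₁) hQ hL₁⟩

/-- **All `R₀`-frames of one datum generate the same ideal of `𝓞_{ℂ_p}⟦T⟧`** (corollary, both frames
`R₀`-valued): for `p ≠ 2`, `K` imaginary quadratic, `κ` anticyclotomic with topological generator `γ`,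
two `L, L' ∈ R₀⟦T⟧` with `IsBDPLFunction ι 𝔭 κ γ f Ω_K Ω_p L`, `IsBDPLFunction ι 𝔭 κ γ f Ω_K' Ω_p' L'`
(non-zero periods) have `Ideal.span {map L'} = Ideal.span {map L}` in `𝓞_{ℂ_p}⟦T⟧`.
[cite: Castella2018, Thm. 3.1 (arXiv:1704.06608 p. 9)] -/
theorem span_map_eq_span_map_of_isBDPLFunction (hp2 : p ≠ 2) (hK : IsImaginaryQuadratic K)
    (hκ : κ.IsAnticyclotomic) (hγ : κ.IsTopGenerator γ)
    {ΩK ΩK' : ℂ} {Ωp Ωp' : ℂ_[p]} {L L' : UnrSeries p}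
    (hΩK : ΩK ≠ 0) (hΩK' : ΩK' ≠ 0) (hΩp : Ωp ≠ 0) (hΩp' : Ωp' ≠ 0)
    (hL : IsBDPLFunction ι 𝔭 κ γ f ΩK Ωp L) (hL' : IsBDPLFunction ι 𝔭 κ γ f ΩK' Ωp' L') :
    Ideal.span {PowerSeries.map (R1.unrToCpInt p) L'} =
      Ideal.span {PowerSeries.map (R1.unrToCpInt p) L} :=
  R1.span_singleton_eq_of_isBDPLFunctionInt hp2 hK hκ hγ hΩK hΩK' hΩp hΩp'
    (R1.isBDPLFunctionInt_map hL) (R1.isBDPLFunctionInt_map hL')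

end Summit.BirchSwinnertonDyer.BirchSwinnertonDyer.Theorems.BiquadraticEisensteinDescentEisensteinDivisibilityCMInertBadFlatAtOneStubEa

end
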